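import Summits.NavierStokesRegularity.NavierStokesRegularity.Theorems.ExtremiserTransienceNearExtremalTransienceDSSLogMean
import HarnessLib

/-!
# Route `ExtremiserTransience`, crux `NearExtremalTransience` (stmt-NavierStokesRegularity-21883):
# THE DSS STRATUM FLOW BY FLOW, UNCONDITIONALLY — sub-extremal, or extremal at almost every phase

`--supports stmt-NavierStokesRegularity-21883` (route-independent). Author: prover seat `ns-et-p1` (g2), on
`…SharpConstant`, `…Scaling`, `…DSSLogMean` (companion of `…DSSPerFlow`). `κ⋆ = sInf` of the universal depletion constants (spelled out).

* `minimalCoeff_le_sharp` — along every classical Leray–Hopf rapidly-decaying-datum flow on `[0,T)` every minimal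
  flow-wise coefficient satisfies `k₀(t) ≤ κ⋆` for `t ∈ [0,T)` (`κ⋆` is universal and the slices are admissible,
  `flowwise_of_universal sharpDepletion_is_universal`).
* `dss_perFlow_dichotomy` — **unconditional per-flow dichotomy on the DSS stratum.** For a classical Leray–Hopf
  rapidly-decaying-datum flow on `[0,T)` that is discretely self-similar about `T` with factor `c > 1`, a measurable
  minimal coefficient `k₀ : ℝ → [0,1]` on `[0,T)` and an onset `t₁ ∈ [0,T)`: EITHER `k₀ = κ⋆` almost everywhere on the
  first period `(t₁, T − (T−t₁)/c²]` (the set `{k₀ < κ⋆}` is null there; with `minimalCoeff_le_sharp` this is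
  `k₀ = κ⋆` a.e., i.e. almost every slice of the period is an EXACT maximiser of the sharp depletion inequality — and
  by log-periodicity, `minimalCoeff_logPeriodic_of_dss`, so is a.e. slice of `[t₁,T)`), OR the flow is log-mean
  sub-extremal with ITS OWN `θ < 1`: `∫_{t₁}^t k₀²/(T−τ) ≤ (θκ⋆)² log((T−t₁)/(T−t)) + I₀` on `[t₁,T)`.

So a DSS Type-I singular flow can defeat per-flow sub-extremality only by being built from exact maximisers of `R` at
almost every phase; the crux's BC5 rung asks in addition for ONE `θ` over all DSS flows. WHAT THIS IS NOT: neither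
alternative is excluded or exhibited for any actual flow; no DSS blow-up is constructed or excluded; the crux, its BC5
rung, the route and the summit stay open; Navier–Stokes regularity is NOT proved. [folklore]
-/

noncomputable section

open Set Filter Topology MeasureTheory
open scoped InnerProductSpace RealInnerProductSpace ENNReal NNReal ContDiff
open Literature.Analysis.FluidPDE

namespace Summit.NavierStokesRegularity.NavierStokesRegularity.Theorems

-- the problem directory repeats the summit name (`NavierStokesRegularity/NavierStokesRegularity`)
set_option linter.dupNamespace false

namespace DepletionLadder

/-- **Minimal coefficients never exceed `κ⋆`.** Along a classical Leray–Hopf rapidly-decaying-datum flow on `[0,T)`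
(`ν, T > 0`), a coefficient `k₀` minimal at every `t ∈ [0,T)` satisfies `k₀(t) ≤ κ⋆` there: `κ⋆` is a universal
depletion constant (`sharpDepletion_is_universal`) hence a flow-wise one (`flowwise_of_universal`). [folklore] -/
theorem minimalCoeff_le_sharp {ν T : ℝ} (hν : 0 < ν) (hT : 0 < T)
    {u : ℝ → EuclideanSpace ℝ (Fin 3) → EuclideanSpace ℝ (Fin 3)} {p : ℝ → EuclideanSpace ℝ (Fin 3) → ℝ}
    (hsol : IsClassicalNSSolutionOn (Ico 0 T) ν 0 u p) (hLH : IsLerayHopfOn T ν 0 (u 0) u)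
    (hdec : HasRapidSpatialDecay (u 0))
    {k₀ : ℝ → ℝ}
    (hmin : (∀ t ∈ Ico 0 T, ∀ c : ℝ, 0 ≤ c →
      (∀ M : ℝ, (∀ x, ‖u t x‖ ≤ M) →
        |∫ x, ⟪curl (u t) x, fderiv ℝ (u t) x (curl (u t) x)⟫_ℝ| ≤
          c * M * Real.sqrt (∫ x, ‖curl (u t) x‖ ^ 2) *
            Real.sqrt (∫ x, frobeniusNormSq (fderiv ℝ (curl (u t)) x))) → k₀ t ≤ c)) :
    ∀ t ∈ Ico 0 T, k₀ t ≤ sInf {κ : ℝ | (∀ (v : EuclideanSpace ℝ (Fin 3) → EuclideanSpace ℝ (Fin 3)) (M B : ℝ), ContDiff ℝ (⊤ : ℕ∞) v → Literature.Analysis.FluidPDE.VectorCalculus.IsDivFree v → (∀ x, ‖v x‖ ≤ M) → (∀ x, ‖fderiv ℝ v x‖ ≤ B) → (∫⁻ x, ‖iteratedFDeriv ℝ 0 v x‖ₑ ^ 2 < ⊤) → (∫⁻ x, ‖iteratedFDeriv ℝ 1 v x‖ₑ ^ 2 < ⊤) → (∫⁻ x, ‖iteratedFDeriv ℝ 2 v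 x‖ₑ ^ 2 < ⊤) → |∫ x, ⟪Literature.Analysis.FluidPDE.curl v x, fderiv ℝ v x (Literature.Analysis.FluidPDE.curl v x)⟫_ℝ| ≤ κ * M * Real.sqrt (∫ x, ‖Literature.Analysis.FluidPDE.curl v x‖ ^ 2) * Real.sqrt (∫ x, Literature.Analysis.FluidPDE.frobeniusNormSq (fderiv ℝ (Literature.Analysis.FluidPDE.curl v) x)))} :=
  fun t ht => hmin t ht _ (le_of_lt (lt_trans (by norm_num) sharpDepletion_gt))
    (flowwise_of_universal sharpDepletion_is_universal hν hT hsol hLH hdec t ht)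

/-- **PER-FLOW DICHOTOMY ON THE DSS STRATUM (unconditional).** Let `u` be a classical Leray–Hopf
rapidly-decaying-datum flow on `[0,T)` (`ν, T > 0`), discretely self-similar about `T` with factor `c > 1`; let
`k₀ : ℝ → [0,1]` be measurable, satisfy the flow-wise clause on `[0,T)` and be minimal there; let `t₁ ∈ [0,T)` and
`I₀ = ∫_{t₁}^{T−(T−t₁)/c²} k₀²/(T−τ)` (the period mass). Then either the set `{τ | k₀ τ < κ⋆}` is null in the first
period `(t₁, T−(T−t₁)/c²]` (so `k₀ = κ⋆` a.e. there, by `minimalCoeff_le_sharp`), or there is `θ ∈ [0,1)` with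
`∫_{t₁}^t k₀²/(T−τ) ≤ (θκ⋆)²·log((T−t₁)/(T−t)) + I₀` for all `t ∈ [t₁,T)`. (If the set has positive measure then
`I₀ < κ⋆² log(c²)` by the strict monotonicity of the interval integral, and `logMean_le_periodAverage_of_dss` concludes
with `(θκ⋆)² = I₀/log(c²)`.) [folklore] -/
theorem dss_perFlow_dichotomy
    {c ν T t₁ : ℝ} (hc : 1 < c) (hν : 0 < ν) (hT : 0 < T) (ht₁ : t₁ ∈ Ico 0 T)
    {u : ℝ → EuclideanSpace ℝ (Fin 3) → EuclideanSpace ℝ (Fin 3)} {p : ℝ → EuclideanSpace ℝ (Fin 3) → ℝ}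
    (hsol : IsClassicalNSSolutionOn (Ico 0 T) ν 0 u p) (hLH : IsLerayHopfOn T ν 0 (u 0) u)
    (hdec : HasRapidSpatialDecay (u 0))
    (hdss : IsDiscretelySelfSimilar c (fun s x => u (T + s) x))
    {k₀ : ℝ → ℝ} (hk₀m : Measurable k₀) (hk₀01 : ∀ τ, 0 ≤ k₀ τ ∧ k₀ τ ≤ 1)
    (hcl : (∀ t ∈ Ico 0 T, ∀ M : ℝ, (∀ x, ‖u t x‖ ≤ M) →
      |∫ x, ⟪curl (u t) x, fderiv ℝ (u t) x (curl (u t) x)⟫_ℝ| ≤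
        k₀ t * M * Real.sqrt (∫ x, ‖curl (u t) x‖ ^ 2) *
          Real.sqrt (∫ x, frobeniusNormSq (fderiv ℝ (curl (u t)) x))))
    (hmin : (∀ t ∈ Ico 0 T, ∀ c : ℝ, 0 ≤ c →
      (∀ M : ℝ, (∀ x, ‖u t x‖ ≤ M) →
        |∫ x, ⟪curl (u t) x, fderiv ℝ (u t) x (curl (u t) x)⟫_ℝ| ≤
          c * M * Real.sqrt (∫ x, ‖curl (u t) x‖ ^ 2) *
            Real.sqrt (∫ x, frobeniusNormSq (fderiv ℝ (curl (u t)) x))) → k₀ t ≤ c)) :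
    (volume.restrict (Ioc t₁ (T - (T - t₁) / c ^ 2))) {τ | k₀ τ < sInf {κ : ℝ | (∀ (v : EuclideanSpace ℝ (Fin 3) → EuclideanSpace ℝ (Fin 3)) (M B : ℝ), ContDiff ℝ (⊤ : ℕ∞) v → Literature.Analysis.FluidPDE.VectorCalculus.IsDivFree v → (∀ x, ‖v x‖ ≤ M) → (∀ x, ‖fderiv ℝ v x‖ ≤ B) → (∫⁻ x, ‖iteratedFDeriv ℝ 0 v x‖ₑ ^ 2 < ⊤) → (∫⁻ x, ‖iteratedFDeriv ℝ 1 v x‖ₑ ^ 2 < ⊤) → (∫⁻ x, ‖iteratedFDeriv ℝ 2 v x‖ₑ ^ 2 < ⊤) → |∫ x, ⟪Literature.Analysis.FluidPDE.curl v x, fderiv ℝ v x (Literature.Analysis.FluidPDE.curl v x)⟫_ℝ| ≤ κ * M * Real.sqrt (∫ x, ‖Literature.Analysis.FluidPDE.curl v x‖ ^ 2) * Real.sqrt (∫ x, Literature.Analysis.FluidPDE.frobeniusNormSq (fderiv ℝ (Literature.Analysis.FluidPDE.curl v) x)))}} = 0 ∨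
    ∃ θ : ℝ, 0 ≤ θ ∧ θ < 1 ∧ ∀ t ∈ Ico t₁ T, ∫ τ in t₁..t, k₀ τ ^ 2 / (T - τ) ≤
      (θ * sInf {κ : ℝ | (∀ (v : EuclideanSpace ℝ (Fin 3) → EuclideanSpace ℝ (Fin 3)) (M B : ℝ), ContDiff ℝ (⊤ : ℕ∞) v → Literature.Analysis.FluidPDE.VectorCalculus.IsDivFree v → (∀ x, ‖v x‖ ≤ M) → (∀ x, ‖fderiv ℝ v x‖ ≤ B) → (∫⁻ x, ‖iteratedFDeriv ℝ 0 v x‖ₑ ^ 2 < ⊤) → (∫⁻ x, ‖iteratedFDeriv ℝ 1 v x‖ₑ ^ 2 < ⊤) → (∫⁻ x, ‖iteratedFDeriv ℝ 2 v x‖ₑ ^ 2 < ⊤) → |∫ x, ⟪Literature.Analysis.FluidPDE.curl v x, fderiv ℝ v x (Literature.Analysis.FluidPDE.curl v x)⟫_ℝ| ≤ κ * M * Real.sqrt (∫ x, ‖Literature.Analysis.FluidPDE.curl v x‖ ^ 2) * Real.sqrt (∫ x, Literature.Analysis.FluidPDE.frobeniusNormSq (fderiv ℝ (Literature.Analysis.FluidPDE.curl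 v) x)))}) ^ 2 * Real.log ((T - t₁) / (T - t)) +
        ∫ τ in t₁..(T - (T - t₁) / c ^ 2), k₀ τ ^ 2 / (T - τ) := by
  by_cases hz : (volume.restrict (Ioc t₁ (T - (T - t₁) / c ^ 2))) {τ | k₀ τ < sInf {κ : ℝ | (∀ (v : EuclideanSpace ℝ (Fin 3) → EuclideanSpace ℝ (Fin 3)) (M B : ℝ), ContDiff ℝ (⊤ : ℕ∞) v → Literature.Analysis.FluidPDE.VectorCalculus.IsDivFree v → (∀ x, ‖v x‖ ≤ M) → (∀ x, ‖fderiv ℝ v x‖ ≤ B) → (∫⁻ x, ‖iteratedFDeriv ℝ 0 v x‖ₑ ^ 2 < ⊤) → (∫⁻ x, ‖iteratedFDeriv ℝ 1 v x‖ₑ ^ 2 < ⊤) → (∫⁻ x, ‖iteratedFDeriv ℝ 2 v x‖ₑ ^ 2 < ⊤) → |∫ x, ⟪Literature.Analysis.FluidPDE.curl v x, fderiv ℝ v x (Literature.Analysis.FluidPDE.curl v x)⟫_ℝ| ≤ κ * M * Real.sqrt (∫ x, ‖Literature.Analysis.FluidPDE.curl v x‖ ^ 2) * Real.sqrt (∫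 x, Literature.Analysis.FluidPDE.frobeniusNormSq (fderiv ℝ (Literature.Analysis.FluidPDE.curl v) x)))}} = 0
  · exact Or.inl hz
  right
  have hc0 : 0 < c := lt_trans one_pos hc
  have hc2 : 1 < c ^ 2 := by nlinarith
  have hℓ : 0 < Real.log (c ^ 2) := Real.log_pos hc2
  have hTt₁ : 0 < T - t₁ := sub_pos.2 ht₁.2
  have hκpos : 0 < sInf {κ : ℝ | (∀ (v : EuclideanSpace ℝ (Fin 3) → EuclideanSpace ℝ (Fin 3)) (M B : ℝ), ContDiff ℝ (⊤ : ℕ∞) v → Literature.Analysis.FluidPDE.VectorCalculus.IsDivFree v → (∀ x, ‖v x‖ ≤ M) → (∀ x, ‖fderiv ℝ v x‖ ≤ B) → (∫⁻ x, ‖iteratedFDeriv ℝ 0 v x‖ₑ ^ 2 < ⊤) → (∫⁻ x, ‖iteratedFDeriv ℝ 1 v x‖ₑ ^ 2 < ⊤) → (∫⁻ x, ‖iteratedFDeriv ℝ 2 v x‖ₑ ^ 2 < ⊤) → |∫ x, ⟪Literature.Analysis.FluidPDE.curl v x, fderiv ℝ v x (Literature.Analysis.FluidPDE.curl v x)⟫_ℝ|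 ≤ κ * M * Real.sqrt (∫ x, ‖Literature.Analysis.FluidPDE.curl v x‖ ^ 2) * Real.sqrt (∫ x, Literature.Analysis.FluidPDE.frobeniusNormSq (fderiv ℝ (Literature.Analysis.FluidPDE.curl v) x)))} := lt_trans (by norm_num) sharpDepletion_gt
  set s₁ : ℝ := T - (T - t₁) / c ^ 2 with hs₁
  have hlt₁ : t₁ < s₁ := by
    have h : (T - t₁) / c ^ 2 < T - t₁ := div_lt_self hTt₁ hc2
    rw [hs₁]; linarith
  have hs₁T : s₁ < T := by
    have : 0 < (T - t₁) / c ^ 2 := div_pos hTt₁ (by positivity)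
    rw [hs₁]; linarith
  set I₀ : ℝ := ∫ τ in t₁..s₁, k₀ τ ^ 2 / (T - τ) with hI₀
  have hI₀0 : 0 ≤ I₀ :=
    intervalIntegral.integral_nonneg hlt₁.le fun τ hτ => div_nonneg (sq_nonneg _) (by linarith [hτ.2])
  -- the constant block mass
  have hconst : ∫ τ in t₁..s₁, sInf {κ : ℝ | (∀ (v : EuclideanSpace ℝ (Fin 3) → EuclideanSpace ℝ (Fin 3)) (M B : ℝ), ContDiff ℝ (⊤ : ℕ∞) v → Literature.Analysis.FluidPDE.VectorCalculus.IsDivFree v → (∀ x, ‖v x‖ ≤ M) → (∀ x, ‖fderiv ℝ v x‖ ≤ B) → (∫⁻ x, ‖iteratedFDeriv ℝ 0 v x‖ₑ ^ 2 < ⊤) → (∫⁻ x, ‖iteratedFDeriv ℝ 1 v x‖ₑ ^ 2 < ⊤) → (∫⁻ x, ‖iteratedFDeriv ℝ 2 v x‖ₑ ^ 2 < ⊤) → |∫ x, ⟪Literature.Analysis.FluidPDE.curl v x, fderiv ℝ v x (Literature.Analysis.FluidPDE.curl v x)⟫_ℝ| ≤ κ * M * Real.sqrt (∫ x, ‖Literature.Analysis.FluidPDE.curl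 v x‖ ^ 2) * Real.sqrt (∫ x, Literature.Analysis.FluidPDE.frobeniusNormSq (fderiv ℝ (Literature.Analysis.FluidPDE.curl v) x)))} ^ 2 / (T - τ) = sInf {κ : ℝ | (∀ (v : EuclideanSpace ℝ (Fin 3) → EuclideanSpace ℝ (Fin 3)) (M B : ℝ), ContDiff ℝ (⊤ : ℕ∞) v → Literature.Analysis.FluidPDE.VectorCalculus.IsDivFree v → (∀ x, ‖v x‖ ≤ M) → (∀ x, ‖fderiv ℝ v x‖ ≤ B) → (∫⁻ x, ‖iteratedFDeriv ℝ 0 v x‖ₑ ^ 2 < ⊤) → (∫⁻ x, ‖iteratedFDeriv ℝ 1 v x‖ₑ ^ 2 < ⊤) → (∫⁻ x, ‖iteratedFDeriv ℝ 2 v x‖ₑ ^ 2 < ⊤) → |∫ x, ⟪Literature.Analysis.FluidPDE.curl v x, fderiv ℝ v x (Literature.Analysis.FluidPDE.curl v x)⟫_ℝ| ≤ κ * M * Real.sqrt (∫ x, ‖Literature.Analysis.FluidPDE.curl v x‖ ^ 2) * Real.sqrt (∫ x, Literature.Analysis.FluidPDE.frobeniusNormSq (fderiv ℝ (Literature.Analysis.FluidPDE.curl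 v) x)))} ^ 2 * Real.log (c ^ 2) := by
    rw [integral_const_div_sub hlt₁.le hs₁T]
    congr 1
    rw [hs₁, show T - (T - (T - t₁) / c ^ 2) = (T - t₁) / c ^ 2 by ring,
      div_div_eq_mul_div, mul_div_cancel_left₀ (c ^ 2) hTt₁.ne']
  -- `k₀ ≤ κ⋆` on `[0,T)`, hence `k₀²/(T−τ) ≤ κ⋆²/(T−τ)` a.e. on the block
  have hle := minimalCoeff_le_sharp hν hT hsol hLH hdec hmin
  have hik : IntervalIntegrable (fun τ => k₀ τ ^ 2 / (T - τ)) volume t₁ s₁ :=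
    intervalIntegrable_coeff_sq_div hk₀m hk₀01 hlt₁.le hs₁T
  have hiK : IntervalIntegrable (fun τ => sInf {κ : ℝ | (∀ (v : EuclideanSpace ℝ (Fin 3) → EuclideanSpace ℝ (Fin 3)) (M B : ℝ), ContDiff ℝ (⊤ : ℕ∞) v → Literature.Analysis.FluidPDE.VectorCalculus.IsDivFree v → (∀ x, ‖v x‖ ≤ M) → (∀ x, ‖fderiv ℝ v x‖ ≤ B) → (∫⁻ x, ‖iteratedFDeriv ℝ 0 v x‖ₑ ^ 2 < ⊤) → (∫⁻ x, ‖iteratedFDeriv ℝ 1 v x‖ₑ ^ 2 < ⊤) → (∫⁻ x, ‖iteratedFDeriv ℝ 2 v x‖ₑ ^ 2 < ⊤) → |∫ x, ⟪Literature.Analysis.FluidPDE.curl v x, fderiv ℝ v x (Literature.Analysis.FluidPDE.curl v x)⟫_ℝ| ≤ κ * M * Real.sqrt (∫ x, ‖Literature.Analysis.FluidPDE.curl v x‖ ^ 2) * Real.sqrt (∫ x, Literature.Analysis.FluidPDE.frobeniusNormSq (fderiv ℝ (Literature.Analysis.FluidPDE.curl v) x)))} ^ 2 / (T - τ)) volume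 t₁ s₁ := by
    refine (ContinuousOn.intervalIntegrable ?_)
    refine ContinuousOn.div continuousOn_const (continuousOn_const.sub continuousOn_id) fun τ hτ => ?_
    rw [uIcc_of_le hlt₁.le] at hτ
    exact (sub_pos.2 (lt_of_le_of_lt hτ.2 hs₁T)).ne'
  have hae : (fun τ => k₀ τ ^ 2 / (T - τ)) ≤ᵐ[volume.restrict (Ioc t₁ s₁)] fun τ => sInf {κ : ℝ | (∀ (v : EuclideanSpace ℝ (Fin 3) → EuclideanSpace ℝ (Fin 3)) (M B : ℝ), ContDiff ℝ (⊤ : ℕ∞) v → Literature.Analysis.FluidPDE.VectorCalculus.IsDivFree v → (∀ x, ‖v x‖ ≤ M) → (∀ x, ‖fderiv ℝ v x‖ ≤ B) → (∫⁻ x, ‖iteratedFDeriv ℝ 0 v x‖ₑ ^ 2 < ⊤) → (∫⁻ x, ‖iteratedFDeriv ℝ 1 v x‖ₑ ^ 2 < ⊤) → (∫⁻ x, ‖iteratedFDeriv ℝ 2 v x‖ₑ ^ 2 < ⊤) → |∫ x, ⟪Literature.Analysis.FluidPDE.curl v x, fderiv ℝ v x (Literature.Analysis.FluidPDE.curl v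 x)⟫_ℝ| ≤ κ * M * Real.sqrt (∫ x, ‖Literature.Analysis.FluidPDE.curl v x‖ ^ 2) * Real.sqrt (∫ x, Literature.Analysis.FluidPDE.frobeniusNormSq (fderiv ℝ (Literature.Analysis.FluidPDE.curl v) x)))} ^ 2 / (T - τ) := by
    refine (ae_restrict_mem measurableSet_Ioc).mono fun τ hτ => ?_
    have hτT : τ ∈ Ico 0 T := ⟨ht₁.1.trans hτ.1.le, lt_of_le_of_lt hτ.2 hs₁T⟩
    have hTτ : 0 < T - τ := sub_pos.2 hτT.2
    exact div_le_div_of_nonneg_right (pow_le_pow_left₀ (hk₀01 τ).1 (hle τ hτT) 2) hTτ.le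
  -- the set where the integrands differ is, inside the block, the set `{k₀ < κ⋆}`
  have hset : (volume.restrict (Ioc t₁ s₁)) {τ | k₀ τ ^ 2 / (T - τ) < sInf {κ : ℝ | (∀ (v : EuclideanSpace ℝ (Fin 3) → EuclideanSpace ℝ (Fin 3)) (M B : ℝ), ContDiff ℝ (⊤ : ℕ∞) v → Literature.Analysis.FluidPDE.VectorCalculus.IsDivFree v → (∀ x, ‖v x‖ ≤ M) → (∀ x, ‖fderiv ℝ v x‖ ≤ B) → (∫⁻ x, ‖iteratedFDeriv ℝ 0 v x‖ₑ ^ 2 < ⊤) → (∫⁻ x, ‖iteratedFDeriv ℝ 1 v x‖ₑ ^ 2 < ⊤) → (∫⁻ x, ‖iteratedFDeriv ℝ 2 v x‖ₑ ^ 2 < ⊤) → |∫ x, ⟪Literature.Analysis.FluidPDE.curl v x, fderiv ℝ v x (Literature.Analysis.FluidPDE.curl v x)⟫_ℝ| ≤ κ * M * Real.sqrt (∫ x, ‖Literature.Analysis.FluidPDE.curl v x‖ ^ 2) * Real.sqrt (∫ x, Literature.Analysis.FluidPDE.frobeniusNormSq (fderiv ℝ (Literature.Analysis.FluidPDE.curl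 v) x)))} ^ 2 / (T - τ)} ≠ 0 := by
    intro h0
    apply hz
    rw [Measure.restrict_apply' measurableSet_Ioc] at h0 ⊢
    have heq : {τ | k₀ τ < sInf {κ : ℝ | (∀ (v : EuclideanSpace ℝ (Fin 3) → EuclideanSpace ℝ (Fin 3)) (M B : ℝ), ContDiff ℝ (⊤ : ℕ∞) v → Literature.Analysis.FluidPDE.VectorCalculus.IsDivFree v → (∀ x, ‖v x‖ ≤ M) → (∀ x, ‖fderiv ℝ v x‖ ≤ B) → (∫⁻ x, ‖iteratedFDeriv ℝ 0 v x‖ₑ ^ 2 < ⊤) → (∫⁻ x, ‖iteratedFDeriv ℝ 1 v x‖ₑ ^ 2 < ⊤) → (∫⁻ x, ‖iteratedFDeriv ℝ 2 v x‖ₑ ^ 2 < ⊤) → |∫ x, ⟪Literature.Analysis.FluidPDE.curl v x, fderiv ℝ v x (Literature.Analysis.FluidPDE.curl v x)⟫_ℝ| ≤ κ * M * Real.sqrt (∫ x, ‖Literature.Analysis.FluidPDE.curl v x‖ ^ 2) * Real.sqrt (∫ x, Literature.Analysis.FluidPDE.frobeniusNormSq (fderiv ℝ (Literature.Analysis.FluidPDE.curl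 v) x)))}} ∩ Ioc t₁ s₁ = {τ | k₀ τ ^ 2 / (T - τ) < sInf {κ : ℝ | (∀ (v : EuclideanSpace ℝ (Fin 3) → EuclideanSpace ℝ (Fin 3)) (M B : ℝ), ContDiff ℝ (⊤ : ℕ∞) v → Literature.Analysis.FluidPDE.VectorCalculus.IsDivFree v → (∀ x, ‖v x‖ ≤ M) → (∀ x, ‖fderiv ℝ v x‖ ≤ B) → (∫⁻ x, ‖iteratedFDeriv ℝ 0 v x‖ₑ ^ 2 < ⊤) → (∫⁻ x, ‖iteratedFDeriv ℝ 1 v x‖ₑ ^ 2 < ⊤) → (∫⁻ x, ‖iteratedFDeriv ℝ 2 v x‖ₑ ^ 2 < ⊤) → |∫ x, ⟪Literature.Analysis.FluidPDE.curl v x, fderiv ℝ v x (Literature.Analysis.FluidPDE.curl v x)⟫_ℝ| ≤ κ * M * Real.sqrt (∫ x, ‖Literature.Analysis.FluidPDE.curl v x‖ ^ 2) * Real.sqrt (∫ x, Literature.Analysis.FluidPDE.frobeniusNormSq (fderiv ℝ (Literature.Analysis.FluidPDE.curl v) x)))} ^ 2 / (T - τ)} ∩ Ioc t₁ s₁ :=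 by
      ext τ
      simp only [mem_inter_iff, mem_setOf_eq]
      constructor
      · rintro ⟨hk, hτ⟩
        have hTτ : 0 < T - τ := sub_pos.2 (lt_of_le_of_lt hτ.2 hs₁T)
        exact ⟨div_lt_div_of_pos_right (pow_lt_pow_left₀ hk (hk₀01 τ).1 two_ne_zero) hTτ, hτ⟩
      · rintro ⟨hk, hτ⟩
        have hTτ : 0 < T - τ := sub_pos.2 (lt_of_le_of_lt hτ.2 hs₁T)
        refine ⟨?_, hτ⟩
        have h2 : k₀ τ ^ 2 < sInf {κ : ℝ | (∀ (v : EuclideanSpace ℝ (Fin 3) → EuclideanSpace ℝ (Fin 3)) (M B : ℝ), ContDiff ℝ (⊤ : ℕ∞) v → Literature.Analysis.FluidPDE.VectorCalculus.IsDivFree v → (∀ x, ‖v x‖ ≤ M) → (∀ x, ‖fderiv ℝ v x‖ ≤ B) → (∫⁻ x, ‖iteratedFDeriv ℝ 0 v x‖ₑ ^ 2 < ⊤) → (∫⁻ x, ‖iteratedFDeriv ℝ 1 v x‖ₑ ^ 2 < ⊤) → (∫⁻ x, ‖iteratedFDeriv ℝ 2 v x‖ₑ ^ 2 < ⊤) →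 |∫ x, ⟪Literature.Analysis.FluidPDE.curl v x, fderiv ℝ v x (Literature.Analysis.FluidPDE.curl v x)⟫_ℝ| ≤ κ * M * Real.sqrt (∫ x, ‖Literature.Analysis.FluidPDE.curl v x‖ ^ 2) * Real.sqrt (∫ x, Literature.Analysis.FluidPDE.frobeniusNormSq (fderiv ℝ (Literature.Analysis.FluidPDE.curl v) x)))} ^ 2 := (div_lt_div_iff_of_pos_right hTτ).1 hk
        exact lt_of_pow_lt_pow_left₀ 2 hκpos.le h2
    rw [heq]
    exact h0
  have hIlt : I₀ < sInf {κ : ℝ | (∀ (v : EuclideanSpace ℝ (Fin 3) → EuclideanSpace ℝ (Fin 3)) (M B : ℝ), ContDiff ℝ (⊤ : ℕ∞) v → Literature.Analysis.FluidPDE.VectorCalculus.IsDivFree v → (∀ x, ‖v x‖ ≤ M) → (∀ x, ‖fderiv ℝ v x‖ ≤ B) → (∫⁻ x, ‖iteratedFDeriv ℝ 0 v x‖ₑ ^ 2 < ⊤) → (∫⁻ x, ‖iteratedFDeriv ℝ 1 v x‖ₑ ^ 2 < ⊤) → (∫⁻ x, ‖iteratedFDeriv ℝ 2 v x‖ₑ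 ^ 2 < ⊤) → |∫ x, ⟪Literature.Analysis.FluidPDE.curl v x, fderiv ℝ v x (Literature.Analysis.FluidPDE.curl v x)⟫_ℝ| ≤ κ * M * Real.sqrt (∫ x, ‖Literature.Analysis.FluidPDE.curl v x‖ ^ 2) * Real.sqrt (∫ x, Literature.Analysis.FluidPDE.frobeniusNormSq (fderiv ℝ (Literature.Analysis.FluidPDE.curl v) x)))} ^ 2 * Real.log (c ^ 2) := by
    rw [hI₀, ← hconst]
    exact intervalIntegral.integral_lt_integral_of_ae_le_of_measure_setOf_lt_ne_zero hlt₁.le hik hiK hae hset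
  -- conclude with the period-average bound
  set A : ℝ := I₀ / Real.log (c ^ 2) with hA
  have hA0 : 0 ≤ A := div_nonneg hI₀0 hℓ.le
  have hAlt : A < sInf {κ : ℝ | (∀ (v : EuclideanSpace ℝ (Fin 3) → EuclideanSpace ℝ (Fin 3)) (M B : ℝ), ContDiff ℝ (⊤ : ℕ∞) v → Literature.Analysis.FluidPDE.VectorCalculus.IsDivFree v → (∀ x, ‖v x‖ ≤ M) → (∀ x, ‖fderiv ℝ v x‖ ≤ B) → (∫⁻ x, ‖iteratedFDeriv ℝ 0 v x‖ₑ ^ 2 < ⊤) → (∫⁻ x, ‖iteratedFDeriv ℝ 1 v x‖ₑ ^ 2 < ⊤) → (∫⁻ x, ‖iteratedFDeriv ℝ 2 v x‖ₑ ^ 2 < ⊤) → |∫ x, ⟪Literature.Analysis.FluidPDE.curl v x, fderiv ℝ v x (Literature.Analysis.FluidPDE.curl v x)⟫_ℝ| ≤ κ * M * Real.sqrt (∫ x, ‖Literature.Analysis.FluidPDE.curl v x‖ ^ 2) * Real.sqrt (∫ x, Literature.Analysis.FluidPDE.frobeniusNormSq (fderiv ℝ (Literature.Analysis.FluidPDE.curl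 v) x)))} ^ 2 := by rw [hA, div_lt_iff₀ hℓ]; exact hIlt
  refine ⟨Real.sqrt A / sInf {κ : ℝ | (∀ (v : EuclideanSpace ℝ (Fin 3) → EuclideanSpace ℝ (Fin 3)) (M B : ℝ), ContDiff ℝ (⊤ : ℕ∞) v → Literature.Analysis.FluidPDE.VectorCalculus.IsDivFree v → (∀ x, ‖v x‖ ≤ M) → (∀ x, ‖fderiv ℝ v x‖ ≤ B) → (∫⁻ x, ‖iteratedFDeriv ℝ 0 v x‖ₑ ^ 2 < ⊤) → (∫⁻ x, ‖iteratedFDeriv ℝ 1 v x‖ₑ ^ 2 < ⊤) → (∫⁻ x, ‖iteratedFDeriv ℝ 2 v x‖ₑ ^ 2 < ⊤) → |∫ x, ⟪Literature.Analysis.FluidPDE.curl v x, fderiv ℝ v x (Literature.Analysis.FluidPDE.curl v x)⟫_ℝ| ≤ κ * M * Real.sqrt (∫ x, ‖Literature.Analysis.FluidPDE.curl v x‖ ^ 2) * Real.sqrt (∫ x, Literature.Analysis.FluidPDE.frobeniusNormSq (fderiv ℝ (Literature.Analysis.FluidPDE.curl v) x)))}, div_nonneg (Real.sqrt_nonneg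 _) hκpos.le, ?_, ?_⟩
  · rw [div_lt_one hκpos, Real.sqrt_lt' hκpos]
    exact hAlt
  · intro t ht
    have hsq : (Real.sqrt A / sInf {κ : ℝ | (∀ (v : EuclideanSpace ℝ (Fin 3) → EuclideanSpace ℝ (Fin 3)) (M B : ℝ), ContDiff ℝ (⊤ : ℕ∞) v → Literature.Analysis.FluidPDE.VectorCalculus.IsDivFree v → (∀ x, ‖v x‖ ≤ M) → (∀ x, ‖fderiv ℝ v x‖ ≤ B) → (∫⁻ x, ‖iteratedFDeriv ℝ 0 v x‖ₑ ^ 2 < ⊤) → (∫⁻ x, ‖iteratedFDeriv ℝ 1 v x‖ₑ ^ 2 < ⊤) → (∫⁻ x, ‖iteratedFDeriv ℝ 2 v x‖ₑ ^ 2 < ⊤) → |∫ x, ⟪Literature.Analysis.FluidPDE.curl v x, fderiv ℝ v x (Literature.Analysis.FluidPDE.curl v x)⟫_ℝ| ≤ κ * M * Real.sqrt (∫ x, ‖Literature.Analysis.FluidPDE.curl v x‖ ^ 2) * Real.sqrt (∫ x, Literature.Analysis.FluidPDE.frobeniusNormSq (fderiv ℝ (Literature.Analysis.FluidPDE.curl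 v) x)))} * sInf {κ : ℝ | (∀ (v : EuclideanSpace ℝ (Fin 3) → EuclideanSpace ℝ (Fin 3)) (M B : ℝ), ContDiff ℝ (⊤ : ℕ∞) v → Literature.Analysis.FluidPDE.VectorCalculus.IsDivFree v → (∀ x, ‖v x‖ ≤ M) → (∀ x, ‖fderiv ℝ v x‖ ≤ B) → (∫⁻ x, ‖iteratedFDeriv ℝ 0 v x‖ₑ ^ 2 < ⊤) → (∫⁻ x, ‖iteratedFDeriv ℝ 1 v x‖ₑ ^ 2 < ⊤) → (∫⁻ x, ‖iteratedFDeriv ℝ 2 v x‖ₑ ^ 2 < ⊤) → |∫ x, ⟪Literature.Analysis.FluidPDE.curl v x, fderiv ℝ v x (Literature.Analysis.FluidPDE.curl v x)⟫_ℝ| ≤ κ * M * Real.sqrt (∫ x, ‖Literature.Analysis.FluidPDE.curl v x‖ ^ 2) * Real.sqrt (∫ x, Literature.Analysis.FluidPDE.frobeniusNormSq (fderiv ℝ (Literature.Analysis.FluidPDE.curl v) x)))}) ^ 2 = A := by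
      rw [div_mul_cancel₀ _ hκpos.ne', Real.sq_sqrt hA0]
    rw [hsq, hA, hI₀, hs₁]
    exact logMean_le_periodAverage_of_dss hc hT ht₁ hdss hk₀m hk₀01 hcl hmin t ht

end DepletionLadder

end Summit.NavierStokesRegularity.NavierStokesRegularity.Theorems

end
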